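import Mathlib
import HarnessLib
import Summits.HubbardSuperconductivity.HubbardSuperconductivity.Theorems.KLProgrammeKLRegimeEnginePairTransferDLineRoomReading

/-!
# Route `KLProgramme` — ENGINE item stmt-HubbardSuperconductivity-20437 `KLRegimeEngineV17F2`, class-#5 STEP (X).3: the `D`-line masses `WDd / WDx` of
# `klmd_defectDiff_le_masses_family` for EVERY pair `n + 1 ≤ j′ ≤ j` — EDGE `j′ = n + 1` INCLUDED — ABOVE the leg-transfer threshold `Λₙ₊₁/8 ≤ G·|transfer|_𝕋`:
# the two-shell law in the ROOM's `min`/`2⁻ⁿ` slots with the `4^{−(j′−n)}` (`= 1/4` at the edge) prefactor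
# (cell gate-hubbard-kl, seat hubbard-kl-k3c2-p2 g20; located item «(X).3-D-EDGE» of k3c1-p1 g16, CLASS5-RESOLVED-STEP.md §13 (3))

WHY.  Gen 16's `WDd_row_le_slots` / `WDx_row_le_slots` (…DLineRoomReading) carry the guard `n + 2 ≤ j′`: it is used ONLY to put the `D`-disc `ρ < Λ_{j′}` inside
`ρ < Λ(t)/4`, which gives (a) `2Λ_{j′} ≤ Λ(t)` for `twoShell_weighted_sum_le` and (b) the VANISHING of the row below the small-transfer threshold (support separation).
At the edge `j′ = n+1` (the PINNED pair `(s_{n+1,j} | 0)` of rev 2's consumer clause; `D = s_{n+1,j}` on `ρ < Λₙ₊₁`) (b) is genuinely lost for `t > 2/3`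
(`Λ(t) < 2Λₙ₊₁`: the slice band `[Λ(t)/2, Λ(t)]` meets the disc), but (a) is only a convenience: reading the two-shell package with the PARTNER shell
`|e_K| ≤ Λₙ` (`⊇ |e_K| ≤ Λ(t)`, and `2Λ_{j′} ≤ 2Λₙ₊₁ ≤ Λₙ`) costs nothing in the slots' currency.  So ABOVE the threshold the two-shell law holds for every
`n + 1 ≤ j′ ≤ j` with the SAME `4^{−(j′−n)}` prefactor (`K′ = K/4` at the edge):
* §1 `twoShell_weighted_sum_le_of_le` — `twoShell_weighted_sum_le` read with a larger partner shell `ε₂ ≤ ε₂′`, `2Λ′ ≤ ε₂′`, `ε₂′ + Gδ ≤ klE0` (monotonicity of the filter);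
* §2 **`WDd_sum_le_twoShell_edge`** / **`WDx_sum_le_twoShell_edge`** — `n + 1 ≤ j′ ≤ j`, `t ∈ [0,1]`, `Λₙ + Gδ ≤ klE0`, `0 < r ≤ |transfer|_𝕋`:
  `WDd ≤ (512/3)(βL²)²/Λ(t)²·(9AL²/(2π²))·((Λₙ+Gδ)/r + √(Λₙ+Gδ))·[(βΛ_{j′}/π)(10+2Gβ/L) + 12Gβ/L]` (crossed: `256/3`, transfer `x + y − Q_m`);
* the slots reading in the TAIL regime `Λₙ₊₁ ≤ 8·G·|transfer|_𝕋` (`WDd/WDx_edge_row_le_slots`, constant `2048·G²`) is the companion `…DLineEdgeRoomReading`.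
WHAT IS NOT HERE (located, «(X).3-D-EDGE-FORWARD»): BELOW the threshold at the edge the sign-blind mass has NO gain — at `t = 1`, `x = y` the product
`D(p)·ẇ_{Λₙ₊₁}(p) = (1 − χ₂(ρ²/Λₙ₊₁²))·χ₂′(ρ²/Λₙ₊₁²)(2ρ²/Λₙ₊₁³)` lives on the whole half-shell `Λₙ₊₁/2 ≤ ρ ≤ Λₙ₊₁`, so `(Λₙ−Λₙ₊₁)(βL²)⁻³·WDd(1,x,x)` is an
`n`-independent multiple of `klSoftMass`, i.e. a slot-shaped (`min`/`2⁻ⁿ`) sign-blind edge row is FALSE there; the forward window of the pinned pair goes through the ROWS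
door with the SIGNED rows `klms_dLine_adjacent_direct/crossed_signed_le` (…PHSignedGeneric / …PHCrossedSignedGeneric, landed g17), whose zero-sound monomial
`ZS₀·Λₙ₊₁` is exactly the ROOM's `(4ⁿ⁺¹)⁻¹·klIdxOverlap (n+1) (n+1)` slot (companion file …PairTransferDLineEdgeForward).
Counting/arithmetic over landed packages; nothing about the model's kernel sizes is asserted; nothing asserts (X).3, (c), K3 or superconductivity.  0 kit · 0 lit.
-/

noncomputable section

namespace Summit.HubbardSuperconductivity.HubbardSuperconductivity.Theorems.KLRegimeSplit

set_option linter.dupNamespace false -- summit = problem name (single-conjunct summit), D-0017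

open Real Finset Set Literature.MathematicalPhysics.QuantumLattice Literature.Probability.LatticeModels
open Literature.MathematicalPhysics.QuantumLattice.FermiRG
open Summit.HubbardSuperconductivity.HubbardSuperconductivity.Theorems.KLProgrammeLegKernels
open Summit.HubbardSuperconductivity.HubbardSuperconductivity.Theorems.TwoPointAssembly
open Summit.HubbardSuperconductivity.HubbardSuperconductivity.Theorems.DispersionFlow
open Summit.HubbardSuperconductivity.HubbardSuperconductivity.Theorems.KLRegimeWick
open Summit.HubbardSuperconductivity.HubbardSuperconductivity.Theorems.EngineV8

variable {L M : ℕ} (β μ : ℝ) (K : TrigPolyC4v)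

/-! ## §1 The weighted two-shell mass with a larger partner shell -/

omit K μ β in
/-- **`twoShell_weighted_sum_le` with a larger partner shell**: if `ε₂ ≤ ε₂′`, `2Λ′ ≤ ε₂′` and `ε₂′ + Gδ ≤ klE0`, the `1/ρ`-weighted mass of the set
`{ρ ≤ Λ′, |e_K(k̃ − w̃)| ≤ ε₂}` is bounded by the two-shell bound AT `ε₂′` (the set only grows with the partner shell). -/
theorem twoShell_weighted_sum_le_of_le {A : ℝ} {u : RenConsts → ℝ} (h : TwoShellFrameAreaAt A u) (hA : 0 ≤ A) {R : RenConsts} (hR : R.WF2)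
    {U : ℝ} (hU : 0 < U) (hUu : U ≤ u R) {μ : ℝ} (hμ : μ ∈ klWindowC) {N : ℕ} {K : TrigPolyC4v} (hK : FrameOK R U N μ K)
    [NeZero L] [NeZero M] {β : ℝ} (hβ : 0 < β) {Λ' ε₂ ε₂' : ℝ} (hΛ' : 0 < Λ') (hε : ε₂ ≤ ε₂') (h2Λ : 2 * Λ' ≤ ε₂')
    (h2 : ε₂' + (4 + 8 / 3 * R.Gfr 1 * U ^ 2) * (2 * π / L) ≤ klE0) (wt : TorusSite 2 L) {r : ℝ} (hr : 0 < r) (hrw : r ≤ klTorusNorm L wt) :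
    ∑ p ∈ univ.filter (fun p : FreqMomentum L M => matsubaraFreq β M p.1 ^ 2 + nambuXiCT L μ K p.2 ^ 2 ≤ Λ' ^ 2 ∧ |nambuXiCT L μ K (p.2 - wt)| ≤ ε₂),
        (Real.sqrt (matsubaraFreq β M p.1 ^ 2 + nambuXiCT L μ K p.2 ^ 2))⁻¹ ≤
      9 * A * (L : ℝ) ^ 2 / (2 * π ^ 2) *
        ((ε₂' + (4 + 8 / 3 * R.Gfr 1 * U ^ 2) * (2 * π / L)) / r + Real.sqrt (ε₂' + (4 + 8 / 3 * R.Gfr 1 * U ^ 2) * (2 * π / L))) *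
        (β * Λ' / π * (10 + 2 * (4 + 8 / 3 * R.Gfr 1 * U ^ 2) * β / L) + 12 * (4 + 8 / 3 * R.Gfr 1 * U ^ 2) * β / L) := by
  classical
  have hsub : (univ.filter fun p : FreqMomentum L M => matsubaraFreq β M p.1 ^ 2 + nambuXiCT L μ K p.2 ^ 2 ≤ Λ' ^ 2 ∧ |nambuXiCT L μ K (p.2 - wt)| ≤ ε₂) ⊆
      univ.filter fun p : FreqMomentum L M => matsubaraFreq β M p.1 ^ 2 + nambuXiCT L μ K p.2 ^ 2 ≤ Λ' ^ 2 ∧ |nambuXiCT L μ K (p.2 - wt)| ≤ ε₂' := by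
    intro p hp
    obtain ⟨h1, h2⟩ := (mem_filter.1 hp).2
    exact mem_filter.2 ⟨Finset.mem_univ _, h1, h2.trans hε⟩
  refine (Finset.sum_le_sum_of_subset_of_nonneg hsub fun p _ _ => inv_nonneg.2 (Real.sqrt_nonneg _)).trans ?_
  exact twoShell_weighted_sum_le h hA hR hU hUu hμ hK hβ hΛ' h2Λ h2 wt hr hrw

/-! ## §2 The `D`-rows above threshold for every `n + 1 ≤ j′ ≤ j`: the two-shell law with partner shell `Λₙ` -/

omit K μ β in
/-- `n + 1 ≤ j′ ⇒ 2Λ_{j′} ≤ Λₙ` (`Λ_{j′} ≤ Λₙ₊₁ = Λₙ/4`). -/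
theorem two_mul_klScale_le_of_succ_le {n j' : ℕ} (hj' : n + 1 ≤ j') : 2 * klScale klE0 j' ≤ klScale klE0 n := by
  have h1 : klScale klE0 j' ≤ klScale klE0 (n + 1) := klld_klScale_anti hj'
  rw [klth_klScale_succ] at h1
  linarith [klth_klScale_pos n]

/-- **`WDd ≤` the weighted two-shell mass, every pair `n + 1 ≤ j′ ≤ j` (edge included).**  For `TwoShellFrameAreaAt A u` (`0 ≤ A`), `R.WF2`, `0 < U ≤ u R`,
`μ ∈ klWindowC`, `FrameOK R U N μ K`, `0 < β`, `n + 1 ≤ j′ ≤ j`, `t ∈ [0,1]`, `Λₙ + Gδ ≤ klE0` and `0 < r ≤ |x − y|_𝕋`: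
`WDd(t,x,y) ≤ (512/3)·(βL²)²/Λ(t)²·(9AL²/(2π²))·((Λₙ+Gδ)/r + √(Λₙ+Gδ))·[(βΛ_{j′}/π)(10 + 2Gβ/L) + 12Gβ/L]` (partner shell read at `Λₙ ≥ Λ(t)`). -/
theorem WDd_sum_le_twoShell_edge [NeZero L] [NeZero M] {A : ℝ} {u : RenConsts → ℝ} (h : TwoShellFrameAreaAt A u) (hA : 0 ≤ A) {R : RenConsts}
    (hR : R.WF2) {U : ℝ} (hU : 0 < U) (hUu : U ≤ u R) (hμ : μ ∈ klWindowC) {N : ℕ} (hK : FrameOK R U N μ K) (hβ : 0 < β)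
    (n : ℕ) {j j' : ℕ} (hj' : n + 1 ≤ j') (hjj : j' ≤ j) {t : ℝ} (ht : t ∈ Icc (0 : ℝ) 1)
    (hE0 : klScale klE0 n + (4 + 8 / 3 * R.Gfr 1 * U ^ 2) * (2 * π / L) ≤ klE0) {x y : TorusSite 2 L} {r : ℝ} (hr : 0 < r)
    (hrw : r ≤ klTorusNorm L (x - y)) :
    ∑ p : FreqMomentum L M, ∑ _σ : Fin 2, ∑ p' : FreqMomentum L M,
      (if matsubaraInt M p'.1 + matsubaraInt M (omega0 M) = matsubaraInt M p.1 + matsubaraInt M (omega0 M) ∧ p'.2 = p.2 + x - y then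
        ‖((((softSymbolCompl L M β μ K (n + 1) j p - softSymbolCompl L M β μ K (n + 1) j' p : ℝ)) : ℂ) * (((β * (L : ℝ) ^ 2 : ℝ) : ℂ) * propCT L M β μ K p)) *
            ((((deriv (fun Λ' : ℝ => hubbardCutoffWeightCT L M β μ K Λ' p') (klScale klE0 n + t * (klScale klE0 (n + 1) - klScale klE0 n)) : ℝ)) : ℂ) *
              (((β * (L : ℝ) ^ 2 : ℝ) : ℂ) * propCT L M β μ K p')) +
          ((((deriv (fun Λ' : ℝ => hubbardCutoffWeightCT L M β μ K Λ' p) (klScale klE0 n + t * (klScale klE0 (n + 1) - klScale klE0 n)) : ℝ)) : ℂ) *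
              (((β * (L : ℝ) ^ 2 : ℝ) : ℂ) * propCT L M β μ K p)) *
            ((((softSymbolCompl L M β μ K (n + 1) j p' - softSymbolCompl L M β μ K (n + 1) j' p' : ℝ)) : ℂ) * (((β * (L : ℝ) ^ 2 : ℝ) : ℂ) * propCT L M β μ K p'))‖
      else 0) ≤
      512 / 3 * (β * (L : ℝ) ^ 2) ^ 2 / (klScale klE0 n + t * (klScale klE0 (n + 1) - klScale klE0 n)) ^ 2 *
        (9 * A * (L : ℝ) ^ 2 / (2 * π ^ 2) *
          ((klScale klE0 n + (4 + 8 / 3 * R.Gfr 1 * U ^ 2) * (2 * π / L)) / r +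
            Real.sqrt (klScale klE0 n + (4 + 8 / 3 * R.Gfr 1 * U ^ 2) * (2 * π / L))) *
          (β * klScale klE0 j' / π * (10 + 2 * (4 + 8 / 3 * R.Gfr 1 * U ^ 2) * β / L) + 12 * (4 + 8 / 3 * R.Gfr 1 * U ^ 2) * β / L)) := by
  classical
  set Λ : ℝ := klScale klE0 n + t * (klScale klE0 (n + 1) - klScale klE0 n) with hΛdef
  have hΛ : 0 < Λ := scaleAt_pos n ht
  have hβL : 0 < β * (L : ℝ) ^ 2 := by
    have : (0 : ℝ) < L := by exact_mod_cast Nat.pos_of_ne_zero (NeZero.ne L)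
    positivity
  set G : ℝ := 4 + 8 / 3 * R.Gfr 1 * U ^ 2 with hG
  set q : TorusSite 2 L := x - y with hq
  have hj'0 := klth_klScale_pos j'
  -- the weighted two-shell bound at `(Λ′, ε₂, ε₂′) = (Λ_{j′}, Λ, Λₙ)`
  have h2Λ : 2 * klScale klE0 j' ≤ klScale klE0 n := two_mul_klScale_le_of_succ_le hj'
  have hΛhi : Λ ≤ klScale klE0 n := by have := (scaleAt_mem n ht).2; rw [← hΛdef] at this; exact this
  set W : ℝ := 9 * A * (L : ℝ) ^ 2 / (2 * π ^ 2) * ((klScale klE0 n + G * (2 * π / L)) / r + Real.sqrt (klScale klE0 n + G * (2 * π / L))) *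
      (β * klScale klE0 j' / π * (10 + 2 * G * β / L) + 12 * G * β / L) with hW
  have hWq : ∑ p ∈ univ.filter (fun p : FreqMomentum L M => matsubaraFreq β M p.1 ^ 2 + nambuXiCT L μ K p.2 ^ 2 ≤ klScale klE0 j' ^ 2 ∧
      |nambuXiCT L μ K (p.2 - q)| ≤ Λ), (Real.sqrt (matsubaraFreq β M p.1 ^ 2 + nambuXiCT L μ K p.2 ^ 2))⁻¹ ≤ W :=
    twoShell_weighted_sum_le_of_le h hA hR hU hUu hμ hK hβ hj'0 hΛhi h2Λ hE0 q hr hrw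
  have hrw' : r ≤ klTorusNorm L (-q) := by rw [hq, neg_sub, klvr_klTorusNorm_sub_comm]; exact hrw
  have hWnq : ∑ p ∈ univ.filter (fun p : FreqMomentum L M => matsubaraFreq β M p.1 ^ 2 + nambuXiCT L μ K p.2 ^ 2 ≤ klScale klE0 j' ^ 2 ∧
      |nambuXiCT L μ K (p.2 - -q)| ≤ Λ), (Real.sqrt (matsubaraFreq β M p.1 ^ 2 + nambuXiCT L μ K p.2 ^ 2))⁻¹ ≤ W :=
    twoShell_weighted_sum_le_of_le h hA hR hU hUu hμ hK hβ hj'0 hΛhi h2Λ hE0 (-q) hr hrw'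
  -- abbreviations for the two weights
  set D : FreqMomentum L M → ℝ := fun p => softSymbolCompl L M β μ K (n + 1) j p - softSymbolCompl L M β μ K (n + 1) j' p with hDdef
  set Wd : FreqMomentum L M → ℝ := fun p => deriv (fun Λ' : ℝ => hubbardCutoffWeightCT L M β μ K Λ' p) Λ with hWddef
  -- step 1: collapse the partner sum and the spin sum
  have hcollapse : ∀ p : FreqMomentum L M,
      (∑ _σ : Fin 2, ∑ p' : FreqMomentum L M,
        (if matsubaraInt M p'.1 + matsubaraInt M (omega0 M) = matsubaraInt M p.1 + matsubaraInt M (omega0 M) ∧ p'.2 = p.2 + x - y then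
          ‖(((D p : ℝ) : ℂ) * (((β * (L : ℝ) ^ 2 : ℝ) : ℂ) * propCT L M β μ K p)) * (((Wd p' : ℝ) : ℂ) * (((β * (L : ℝ) ^ 2 : ℝ) : ℂ) * propCT L M β μ K p')) +
            (((Wd p : ℝ) : ℂ) * (((β * (L : ℝ) ^ 2 : ℝ) : ℂ) * propCT L M β μ K p)) * (((D p' : ℝ) : ℂ) * (((β * (L : ℝ) ^ 2 : ℝ) : ℂ) * propCT L M β μ K p'))‖
        else 0)) =
      2 * ‖(((D p : ℝ) : ℂ) * (((β * (L : ℝ) ^ 2 : ℝ) : ℂ) * propCT L M β μ K p)) *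
            (((Wd (p.1, p.2 + q) : ℝ) : ℂ) * (((β * (L : ℝ) ^ 2 : ℝ) : ℂ) * propCT L M β μ K (p.1, p.2 + q))) +
          (((Wd p : ℝ) : ℂ) * (((β * (L : ℝ) ^ 2 : ℝ) : ℂ) * propCT L M β μ K p)) *
            (((D (p.1, p.2 + q) : ℝ) : ℂ) * (((β * (L : ℝ) ^ 2 : ℝ) : ℂ) * propCT L M β μ K (p.1, p.2 + q)))‖ := by
    intro p
    rw [sum_partner_ite_eq x y p, Finset.sum_const, Finset.card_univ, Fintype.card_fin, nsmul_eq_mul]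
    have e : p.2 + x - y = p.2 + q := by rw [hq]; abel
    rw [e]
    norm_num
  -- step 2: the two products against the indicators
  have hT : ∀ p : FreqMomentum L M,
      ‖(((D p : ℝ) : ℂ) * (((β * (L : ℝ) ^ 2 : ℝ) : ℂ) * propCT L M β μ K p)) *
            (((Wd (p.1, p.2 + q) : ℝ) : ℂ) * (((β * (L : ℝ) ^ 2 : ℝ) : ℂ) * propCT L M β μ K (p.1, p.2 + q))) +
          (((Wd p : ℝ) : ℂ) * (((β * (L : ℝ) ^ 2 : ℝ) : ℂ) * propCT L M β μ K p)) *
            (((D (p.1, p.2 + q) : ℝ) : ℂ) * (((β * (L : ℝ) ^ 2 : ℝ) : ℂ) * propCT L M β μ K (p.1, p.2 + q)))‖ ≤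
      (β * (L : ℝ) ^ 2) ^ 2 * (128 / (3 * Λ ^ 2)) *
        (if matsubaraFreq β M p.1 ^ 2 + nambuXiCT L μ K p.2 ^ 2 ≤ klScale klE0 j' ^ 2 ∧ |nambuXiCT L μ K (p.2 + q)| ≤ Λ then
          (Real.sqrt (matsubaraFreq β M p.1 ^ 2 + nambuXiCT L μ K p.2 ^ 2))⁻¹ else 0) +
      (β * (L : ℝ) ^ 2) ^ 2 * (128 / (3 * Λ ^ 2)) *
        (if matsubaraFreq β M (p.1, p.2 + q).1 ^ 2 + nambuXiCT L μ K (p.1, p.2 + q).2 ^ 2 ≤ klScale klE0 j' ^ 2 ∧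
            |nambuXiCT L μ K ((p.1, p.2 + q).2 + -q)| ≤ Λ then
          (Real.sqrt (matsubaraFreq β M (p.1, p.2 + q).1 ^ 2 + nambuXiCT L μ K (p.1, p.2 + q).2 ^ 2))⁻¹ else 0) := by
    intro p
    refine (norm_add_le _ _).trans (add_le_add ?_ ?_)
    · rw [norm_weightProd_eq hβ]
      exact dirProd_le_indicator hβ μ K n hjj hΛ q p
    · rw [norm_weightProd_eq hβ]
      have h := dirProd_le_indicator hβ μ K n hjj hΛ (-q) (p.1, p.2 + q)
      have e : (p.1, p.2 + q).2 + -q = p.2 := by simp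
      simp only [e] at h ⊢
      calc |Wd p| * ((β * (L : ℝ) ^ 2) * ‖propCT L M β μ K p‖) * (|D (p.1, p.2 + q)| * ((β * (L : ℝ) ^ 2) * ‖propCT L M β μ K (p.1, p.2 + q)‖))
          = |D (p.1, p.2 + q)| * ((β * (L : ℝ) ^ 2) * ‖propCT L M β μ K (p.1, p.2 + q)‖) * (|Wd (p.1, p.2)| * ((β * (L : ℝ) ^ 2) * ‖propCT L M β μ K (p.1, p.2)‖)) := by
            simp only [Prod.mk.eta]; ring
        _ ≤ _ := h
  -- step 3: sum, and recognise the two weighted two-shell masses (the second after the shift `k ↦ k + q`)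
  have hS1 : ∑ p : FreqMomentum L M,
      (if matsubaraFreq β M p.1 ^ 2 + nambuXiCT L μ K p.2 ^ 2 ≤ klScale klE0 j' ^ 2 ∧ |nambuXiCT L μ K (p.2 + q)| ≤ Λ then
          (Real.sqrt (matsubaraFreq β M p.1 ^ 2 + nambuXiCT L μ K p.2 ^ 2))⁻¹ else 0) ≤ W := by
    rw [← Finset.sum_filter]
    have e : (univ.filter fun p : FreqMomentum L M => matsubaraFreq β M p.1 ^ 2 + nambuXiCT L μ K p.2 ^ 2 ≤ klScale klE0 j' ^ 2 ∧
        |nambuXiCT L μ K (p.2 + q)| ≤ Λ) = univ.filter fun p : FreqMomentum L M => matsubaraFreq β M p.1 ^ 2 + nambuXiCT L μ K p.2 ^ 2 ≤ klScale klE0 j' ^ 2 ∧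
        |nambuXiCT L μ K (p.2 - -q)| ≤ Λ := by
      congr 1; funext p; rw [sub_neg_eq_add]
    rw [e]; exact hWnq
  have hS2 : ∑ p : FreqMomentum L M,
      (if matsubaraFreq β M (p.1, p.2 + q).1 ^ 2 + nambuXiCT L μ K (p.1, p.2 + q).2 ^ 2 ≤ klScale klE0 j' ^ 2 ∧
            |nambuXiCT L μ K ((p.1, p.2 + q).2 + -q)| ≤ Λ then
          (Real.sqrt (matsubaraFreq β M (p.1, p.2 + q).1 ^ 2 + nambuXiCT L μ K (p.1, p.2 + q).2 ^ 2))⁻¹ else 0) ≤ W := by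
    set g : FreqMomentum L M → ℝ := fun p' => if matsubaraFreq β M p'.1 ^ 2 + nambuXiCT L μ K p'.2 ^ 2 ≤ klScale klE0 j' ^ 2 ∧
        |nambuXiCT L μ K (p'.2 + -q)| ≤ Λ then (Real.sqrt (matsubaraFreq β M p'.1 ^ 2 + nambuXiCT L μ K p'.2 ^ 2))⁻¹ else 0 with hg
    set e : FreqMomentum L M ≃ FreqMomentum L M := Equiv.prodCongr (Equiv.refl _) (Equiv.addRight q) with hedef
    have hsum : ∑ p : FreqMomentum L M, g (e p) = ∑ p : FreqMomentum L M, g p := Equiv.sum_comp e g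
    have e1 : ∀ p : FreqMomentum L M, e p = (p.1, p.2 + q) := fun p => rfl
    simp only [e1, hg] at hsum
    rw [hsum, ← Finset.sum_filter]
    have e2 : (univ.filter fun p : FreqMomentum L M => matsubaraFreq β M p.1 ^ 2 + nambuXiCT L μ K p.2 ^ 2 ≤ klScale klE0 j' ^ 2 ∧
        |nambuXiCT L μ K (p.2 + -q)| ≤ Λ) = univ.filter fun p : FreqMomentum L M => matsubaraFreq β M p.1 ^ 2 + nambuXiCT L μ K p.2 ^ 2 ≤ klScale klE0 j' ^ 2 ∧
        |nambuXiCT L μ K (p.2 - q)| ≤ Λ := by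
      congr 1; funext p; rw [← sub_eq_add_neg]
    rw [e2]; exact hWq
  -- assemble
  have hc : 0 ≤ (β * (L : ℝ) ^ 2) ^ 2 * (128 / (3 * Λ ^ 2)) := by positivity
  calc _ = ∑ p : FreqMomentum L M, 2 * ‖(((D p : ℝ) : ℂ) * (((β * (L : ℝ) ^ 2 : ℝ) : ℂ) * propCT L M β μ K p)) *
            (((Wd (p.1, p.2 + q) : ℝ) : ℂ) * (((β * (L : ℝ) ^ 2 : ℝ) : ℂ) * propCT L M β μ K (p.1, p.2 + q))) +
          (((Wd p : ℝ) : ℂ) * (((β * (L : ℝ) ^ 2 : ℝ) : ℂ) * propCT L M β μ K p)) *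
            (((D (p.1, p.2 + q) : ℝ) : ℂ) * (((β * (L : ℝ) ^ 2 : ℝ) : ℂ) * propCT L M β μ K (p.1, p.2 + q)))‖ := Finset.sum_congr rfl fun p _ => hcollapse p
    _ ≤ ∑ p : FreqMomentum L M, 2 * ((β * (L : ℝ) ^ 2) ^ 2 * (128 / (3 * Λ ^ 2)) *
        (if matsubaraFreq β M p.1 ^ 2 + nambuXiCT L μ K p.2 ^ 2 ≤ klScale klE0 j' ^ 2 ∧ |nambuXiCT L μ K (p.2 + q)| ≤ Λ then
          (Real.sqrt (matsubaraFreq β M p.1 ^ 2 + nambuXiCT L μ K p.2 ^ 2))⁻¹ else 0) +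
      (β * (L : ℝ) ^ 2) ^ 2 * (128 / (3 * Λ ^ 2)) *
        (if matsubaraFreq β M (p.1, p.2 + q).1 ^ 2 + nambuXiCT L μ K (p.1, p.2 + q).2 ^ 2 ≤ klScale klE0 j' ^ 2 ∧
            |nambuXiCT L μ K ((p.1, p.2 + q).2 + -q)| ≤ Λ then
          (Real.sqrt (matsubaraFreq β M (p.1, p.2 + q).1 ^ 2 + nambuXiCT L μ K (p.1, p.2 + q).2 ^ 2))⁻¹ else 0)) :=
        Finset.sum_le_sum fun p _ => mul_le_mul_of_nonneg_left (hT p) (by norm_num)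
    _ = 2 * ((β * (L : ℝ) ^ 2) ^ 2 * (128 / (3 * Λ ^ 2))) * (∑ p : FreqMomentum L M,
        (if matsubaraFreq β M p.1 ^ 2 + nambuXiCT L μ K p.2 ^ 2 ≤ klScale klE0 j' ^ 2 ∧ |nambuXiCT L μ K (p.2 + q)| ≤ Λ then
          (Real.sqrt (matsubaraFreq β M p.1 ^ 2 + nambuXiCT L μ K p.2 ^ 2))⁻¹ else 0) +
        ∑ p : FreqMomentum L M, (if matsubaraFreq β M (p.1, p.2 + q).1 ^ 2 + nambuXiCT L μ K (p.1, p.2 + q).2 ^ 2 ≤ klScale klE0 j' ^ 2 ∧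
            |nambuXiCT L μ K ((p.1, p.2 + q).2 + -q)| ≤ Λ then
          (Real.sqrt (matsubaraFreq β M (p.1, p.2 + q).1 ^ 2 + nambuXiCT L μ K (p.1, p.2 + q).2 ^ 2))⁻¹ else 0)) := by
        rw [← Finset.sum_add_distrib, Finset.mul_sum]
        exact Finset.sum_congr rfl fun p _ => by ring
    _ ≤ 2 * ((β * (L : ℝ) ^ 2) ^ 2 * (128 / (3 * Λ ^ 2))) * (W + W) := by gcongr
    _ = 512 / 3 * (β * (L : ℝ) ^ 2) ^ 2 / Λ ^ 2 * W := by field_simp; ring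

/-- **`WDx ≤` the weighted two-shell mass, every pair `n + 1 ≤ j′ ≤ j` (edge included)** — the crossed twin at transfer `x + y − Q_m` (`256/3`; partner shell
read at `Λₙ`; NO `16π/β ≤ Λₙ₊₁` needed above threshold). -/
theorem WDx_sum_le_twoShell_edge [NeZero L] [NeZero M] {A : ℝ} {u : RenConsts → ℝ} (h : TwoShellFrameAreaAt A u) (hA : 0 ≤ A) {R : RenConsts}
    (hR : R.WF2) {U : ℝ} (hU : 0 < U) (hUu : U ≤ u R) (hμ : μ ∈ klWindowC) {N : ℕ} (hK : FrameOK R U N μ K) (hβ : 0 < β)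
    (n : ℕ) {j j' : ℕ} (hj' : n + 1 ≤ j') (hjj : j' ≤ j) {t : ℝ} (ht : t ∈ Icc (0 : ℝ) 1)
    (hE0 : klScale klE0 n + (4 + 8 / 3 * R.Gfr 1 * U ^ 2) * (2 * π / L) ≤ klE0) {Qm x y : TorusSite 2 L} {r : ℝ} (hr : 0 < r)
    (hrw : r ≤ klTorusNorm L (x + y - Qm)) :
    ∑ p : FreqMomentum L M, ∑ p' : FreqMomentum L M,
      (if matsubaraInt M p'.1 + matsubaraInt M (omega0 M) + matsubaraInt M (omega0 M) + 1 = matsubaraInt M p.1 ∧ p'.2 = p.2 + Qm - x - y then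
        ‖((((softSymbolCompl L M β μ K (n + 1) j p - softSymbolCompl L M β μ K (n + 1) j' p : ℝ)) : ℂ) * (((β * (L : ℝ) ^ 2 : ℝ) : ℂ) * propCT L M β μ K p)) *
            ((((deriv (fun Λ' : ℝ => hubbardCutoffWeightCT L M β μ K Λ' p') (klScale klE0 n + t * (klScale klE0 (n + 1) - klScale klE0 n)) : ℝ)) : ℂ) *
              (((β * (L : ℝ) ^ 2 : ℝ) : ℂ) * propCT L M β μ K p')) +
          ((((deriv (fun Λ' : ℝ => hubbardCutoffWeightCT L M β μ K Λ' p) (klScale klE0 n + t * (klScale klE0 (n + 1) - klScale klE0 n)) : ℝ)) : ℂ) *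
              (((β * (L : ℝ) ^ 2 : ℝ) : ℂ) * propCT L M β μ K p)) *
            ((((softSymbolCompl L M β μ K (n + 1) j p' - softSymbolCompl L M β μ K (n + 1) j' p' : ℝ)) : ℂ) * (((β * (L : ℝ) ^ 2 : ℝ) : ℂ) * propCT L M β μ K p'))‖
      else 0) ≤
      256 / 3 * (β * (L : ℝ) ^ 2) ^ 2 / (klScale klE0 n + t * (klScale klE0 (n + 1) - klScale klE0 n)) ^ 2 *
        (9 * A * (L : ℝ) ^ 2 / (2 * π ^ 2) *
          ((klScale klE0 n + (4 + 8 / 3 * R.Gfr 1 * U ^ 2) * (2 * π / L)) / r +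
            Real.sqrt (klScale klE0 n + (4 + 8 / 3 * R.Gfr 1 * U ^ 2) * (2 * π / L))) *
          (β * klScale klE0 j' / π * (10 + 2 * (4 + 8 / 3 * R.Gfr 1 * U ^ 2) * β / L) + 12 * (4 + 8 / 3 * R.Gfr 1 * U ^ 2) * β / L)) := by
  classical
  set Λ : ℝ := klScale klE0 n + t * (klScale klE0 (n + 1) - klScale klE0 n) with hΛdef
  have hΛ : 0 < Λ := scaleAt_pos n ht
  have hβL : 0 < β * (L : ℝ) ^ 2 := by
    have : (0 : ℝ) < L := by exact_mod_cast Nat.pos_of_ne_zero (NeZero.ne L)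
    positivity
  set G : ℝ := 4 + 8 / 3 * R.Gfr 1 * U ^ 2 with hG
  set q : TorusSite 2 L := Qm - x - y with hq
  have hj'0 := klth_klScale_pos j'
  have h2Λ : 2 * klScale klE0 j' ≤ klScale klE0 n := two_mul_klScale_le_of_succ_le hj'
  have hΛhi : Λ ≤ klScale klE0 n := by have := (scaleAt_mem n ht).2; rw [← hΛdef] at this; exact this
  set W : ℝ := 9 * A * (L : ℝ) ^ 2 / (2 * π ^ 2) * ((klScale klE0 n + G * (2 * π / L)) / r + Real.sqrt (klScale klE0 n + G * (2 * π / L))) *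
      (β * klScale klE0 j' / π * (10 + 2 * G * β / L) + 12 * G * β / L) with hW
  have hrq : r ≤ klTorusNorm L q := by rw [hq, show Qm - x - y = -(x + y - Qm) by abel, klvr_klTorusNorm_neg]; exact hrw
  have hrnq : r ≤ klTorusNorm L (-q) := by rw [hq, show -(Qm - x - y) = x + y - Qm by abel]; exact hrw
  have hWq : ∑ p ∈ univ.filter (fun p : FreqMomentum L M => matsubaraFreq β M p.1 ^ 2 + nambuXiCT L μ K p.2 ^ 2 ≤ klScale klE0 j' ^ 2 ∧
      |nambuXiCT L μ K (p.2 - q)| ≤ Λ), (Real.sqrt (matsubaraFreq β M p.1 ^ 2 + nambuXiCT L μ K p.2 ^ 2))⁻¹ ≤ W :=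
    twoShell_weighted_sum_le_of_le h hA hR hU hUu hμ hK hβ hj'0 hΛhi h2Λ hE0 q hr hrq
  have hWnq : ∑ p ∈ univ.filter (fun p : FreqMomentum L M => matsubaraFreq β M p.1 ^ 2 + nambuXiCT L μ K p.2 ^ 2 ≤ klScale klE0 j' ^ 2 ∧
      |nambuXiCT L μ K (p.2 - -q)| ≤ Λ), (Real.sqrt (matsubaraFreq β M p.1 ^ 2 + nambuXiCT L μ K p.2 ^ 2))⁻¹ ≤ W :=
    twoShell_weighted_sum_le_of_le h hA hR hU hUu hμ hK hβ hj'0 hΛhi h2Λ hE0 (-q) hr hrnq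
  have hW0 : 0 ≤ W := le_trans (Finset.sum_nonneg fun p _ => inv_nonneg.2 (Real.sqrt_nonneg _)) hWq
  -- abbreviations
  set D : FreqMomentum L M → ℝ := fun p => softSymbolCompl L M β μ K (n + 1) j p - softSymbolCompl L M β μ K (n + 1) j' p with hDdef
  set Wd : FreqMomentum L M → ℝ := fun p => deriv (fun Λ' : ℝ => hubbardCutoffWeightCT L M β μ K Λ' p) Λ with hWddef
  set c : FreqMomentum L M → FreqMomentum L M → Prop := fun p p' =>
    matsubaraInt M p'.1 + matsubaraInt M (omega0 M) + matsubaraInt M (omega0 M) + 1 = matsubaraInt M p.1 ∧ p'.2 = p.2 + Qm - x - y with hc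
  set C0 : ℝ := (β * (L : ℝ) ^ 2) ^ 2 * (128 / (3 * Λ ^ 2)) with hC0
  have hC00 : 0 ≤ C0 := by positivity
  -- the two indicator functions
  set gA : FreqMomentum L M → ℝ := fun p => if matsubaraFreq β M p.1 ^ 2 + nambuXiCT L μ K p.2 ^ 2 ≤ klScale klE0 j' ^ 2 ∧
      |nambuXiCT L μ K (p.2 + q)| ≤ Λ then (Real.sqrt (matsubaraFreq β M p.1 ^ 2 + nambuXiCT L μ K p.2 ^ 2))⁻¹ else 0 with hgA
  set gB : FreqMomentum L M → ℝ := fun p' => if matsubaraFreq β M p'.1 ^ 2 + nambuXiCT L μ K p'.2 ^ 2 ≤ klScale klE0 j' ^ 2 ∧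
      |nambuXiCT L μ K (p'.2 - q)| ≤ Λ then (Real.sqrt (matsubaraFreq β M p'.1 ^ 2 + nambuXiCT L μ K p'.2 ^ 2))⁻¹ else 0 with hgB
  have hgA0 : ∀ p, 0 ≤ gA p := fun p => by simp only [hgA]; split_ifs <;> positivity
  have hgB0 : ∀ p, 0 ≤ gB p := fun p => by simp only [hgB]; split_ifs <;> positivity
  -- step 1: split the summand
  have hsplit : ∀ p p' : FreqMomentum L M,
      (if c p p' then ‖(((D p : ℝ) : ℂ) * (((β * (L : ℝ) ^ 2 : ℝ) : ℂ) * propCT L M β μ K p)) * (((Wd p' : ℝ) : ℂ) * (((β * (L : ℝ) ^ 2 : ℝ) : ℂ) * propCT L M β μ K p')) +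
          (((Wd p : ℝ) : ℂ) * (((β * (L : ℝ) ^ 2 : ℝ) : ℂ) * propCT L M β μ K p)) * (((D p' : ℝ) : ℂ) * (((β * (L : ℝ) ^ 2 : ℝ) : ℂ) * propCT L M β μ K p'))‖ else 0) ≤
      (if c p p' then |D p| * ((β * (L : ℝ) ^ 2) * ‖propCT L M β μ K p‖) * (|Wd p'| * ((β * (L : ℝ) ^ 2) * ‖propCT L M β μ K p'‖)) else 0) +
      (if c p p' then |D p'| * ((β * (L : ℝ) ^ 2) * ‖propCT L M β μ K p'‖) * (|Wd p| * ((β * (L : ℝ) ^ 2) * ‖propCT L M β μ K p‖)) else 0) := by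
    intro p p'
    split_ifs with hcc
    · refine (norm_add_le _ _).trans (add_le_add (le_of_eq (norm_weightProd_eq hβ μ K _ _ p p')) (le_of_eq ?_))
      rw [norm_weightProd_eq hβ μ K]; ring
    · simp
  -- step 2: part A — collapse the partner sum at fixed `p`
  have hA' : ∀ p : FreqMomentum L M,
      (∑ p' : FreqMomentum L M, if c p p' then |D p| * ((β * (L : ℝ) ^ 2) * ‖propCT L M β μ K p‖) * (|Wd p'| * ((β * (L : ℝ) ^ 2) * ‖propCT L M β μ K p'‖)) else 0) ≤
      C0 * gA p := by
    intro p
    refine sum_ite_le_of_card_le_one _ _ _ (mul_nonneg hC00 (hgA0 p)) (fun p' _ hcc => ?_) (card_partner_le_one Qm x y p)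
    have hb := crossProd_le_indicator hβ μ K n hjj hΛ p p'
    have e : p'.2 = p.2 + q := by rw [hcc.2, hq]; abel
    rw [e] at hb
    exact hb
  -- step 3: part B — collapse the source sum at fixed `p′`
  have hB' : ∀ p' : FreqMomentum L M,
      (∑ p : FreqMomentum L M, if c p p' then |D p'| * ((β * (L : ℝ) ^ 2) * ‖propCT L M β μ K p'‖) * (|Wd p| * ((β * (L : ℝ) ^ 2) * ‖propCT L M β μ K p‖)) else 0) ≤
      C0 * gB p' := by
    intro p'
    refine sum_ite_le_of_card_le_one _ (fun p => c p p') _ (mul_nonneg hC00 (hgB0 p')) (fun p _ hcc => ?_) (card_source_le_one Qm x y p')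
    have hb := crossProd_le_indicator hβ μ K n hjj hΛ p' p
    have e : p.2 = p'.2 - q := by rw [hcc.2, hq]; abel
    rw [e] at hb
    exact hb
  -- step 4: the two weighted sums
  have hSA : ∑ p : FreqMomentum L M, gA p ≤ W := by
    rw [hgA, ← Finset.sum_filter]
    have e : (univ.filter fun p : FreqMomentum L M => matsubaraFreq β M p.1 ^ 2 + nambuXiCT L μ K p.2 ^ 2 ≤ klScale klE0 j' ^ 2 ∧
        |nambuXiCT L μ K (p.2 + q)| ≤ Λ) = univ.filter fun p : FreqMomentum L M => matsubaraFreq β M p.1 ^ 2 + nambuXiCT L μ K p.2 ^ 2 ≤ klScale klE0 j' ^ 2 ∧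
        |nambuXiCT L μ K (p.2 - -q)| ≤ Λ := by
      congr 1; funext p; rw [sub_neg_eq_add]
    rw [e]; exact hWnq
  have hSB : ∑ p : FreqMomentum L M, gB p ≤ W := by
    rw [hgB, ← Finset.sum_filter]; exact hWq
  -- assemble
  calc _ ≤ ∑ p : FreqMomentum L M, ∑ p' : FreqMomentum L M,
        ((if c p p' then |D p| * ((β * (L : ℝ) ^ 2) * ‖propCT L M β μ K p‖) * (|Wd p'| * ((β * (L : ℝ) ^ 2) * ‖propCT L M β μ K p'‖)) else 0) +
         (if c p p' then |D p'| * ((β * (L : ℝ) ^ 2) * ‖propCT L M β μ K p'‖) * (|Wd p| * ((β * (L : ℝ) ^ 2) * ‖propCT L M β μ K p‖)) else 0)) :=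
        Finset.sum_le_sum fun p _ => Finset.sum_le_sum fun p' _ => hsplit p p'
    _ = ∑ p : FreqMomentum L M, ∑ p' : FreqMomentum L M,
          (if c p p' then |D p| * ((β * (L : ℝ) ^ 2) * ‖propCT L M β μ K p‖) * (|Wd p'| * ((β * (L : ℝ) ^ 2) * ‖propCT L M β μ K p'‖)) else 0) +
        ∑ p' : FreqMomentum L M, ∑ p : FreqMomentum L M,
          (if c p p' then |D p'| * ((β * (L : ℝ) ^ 2) * ‖propCT L M β μ K p'‖) * (|Wd p| * ((β * (L : ℝ) ^ 2) * ‖propCT L M β μ K p‖)) else 0) := by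
        rw [Finset.sum_comm (f := fun p' p => if c p p' then |D p'| * ((β * (L : ℝ) ^ 2) * ‖propCT L M β μ K p'‖) *
          (|Wd p| * ((β * (L : ℝ) ^ 2) * ‖propCT L M β μ K p‖)) else 0), ← Finset.sum_add_distrib]
        exact Finset.sum_congr rfl fun p _ => Finset.sum_add_distrib
    _ ≤ ∑ p : FreqMomentum L M, C0 * gA p + ∑ p' : FreqMomentum L M, C0 * gB p' := add_le_add (Finset.sum_le_sum fun p _ => hA' p) (Finset.sum_le_sum fun p' _ => hB' p')
    _ = C0 * (∑ p : FreqMomentum L M, gA p + ∑ p' : FreqMomentum L M, gB p') := by rw [mul_add, Finset.mul_sum, Finset.mul_sum]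
    _ ≤ C0 * (W + W) := by gcongr
    _ = 256 / 3 * (β * (L : ℝ) ^ 2) ^ 2 / Λ ^ 2 * W := by rw [hC0]; field_simp; ring

end Summit.HubbardSuperconductivity.HubbardSuperconductivity.Theorems.KLRegimeSplit

end
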